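import Mathlib
import Summits.ValiantsHypothesis.ValiantsHypothesis.Theorems.NewtonUnitEquationsDissociatedUniformTotalsLawLeftTurning
import HarnessLib

/-!
# Crux `NewtonUnitEquations.DissociatedUniform` (stmt-ValiantsHypothesis-5905): the uniform union bound for WEAKLY co-oriented pairs (collinear triples allowed)

Companion of `…TotalsLawLifts` / `…TotalsLawLeftTurning` (`unionVert_le_twelve_mul`: `#vert conv U_s(Z) ≤ 12q` for convexly ordered,
injective pairs that are both STRICTLY left- or right-turning).  Strictness was used only cosmetically: the three inequalities that decide the
higher / lower neighbour of a chart mode (the two strict mode inequalities at `x ± 1` and the turn at `x − 1`) close with a WEAK turn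
`det ≥ 0`, and the only other use (some two labels differ in height) is replaced by a case split (constant height ⇒ the maximiser does not
depend on `t`, lift `P = 0`).  Hence:
* `higher_succ_of_mode_weak`, `lower_pred_of_mode_weak`, `pos_le_of_mode_weak`, `pos_lt_pos_of_modes_weak`, **`exists_forward_lift_weak`**
  (weak turn `det(Δ_z, Δ_{z+1}) ≥ 0` at every label);
* `WeakLeftTurning a` / `WeakRightTurning a` (`det ≥ 0` / `≤ 0` everywhere: convex polygons traversed once with collinear consecutive
  triples allowed), `exists_lifts_of_weakLeftTurning` / `…weakRightTurning`;
* **`unionVert_le_twelve_mul_of_weak`**: `a, b` convexly ordered, injective, both weakly left- or both weakly right-turning ⇒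
  `#vert conv U_s(Z) ≤ 12·q` for EVERY `Z`, `s`; `unionTotal_le_twelve_mul_sq_of_weak` (`UT ≤ 12q²`); `totalVert_le_of_weakCoOriented`
  (`T ≤ 12·m·q²` for an `m`-valued third curve).
This covers the DEGENERATE convexly ordered pairs of the census (collinear runs; memo NOTES-t1g5 §3 `anneal_W_degen.py`) as long as both
curves are injective and traversed in the same sense.  NOT covered: contra-oriented pairs, repeated points.
Honest label: a stratum theorem; `ConvexUnionVertBound C` (`C ≥ 3`), `UnionTotalsLaw`, `TotalsLawThree` remain OPEN; nothing here bears on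
VP ≠ VNP.
[folklore]
-/

set_option linter.dupNamespace false -- `ValiantsHypothesis.ValiantsHypothesis` (summit = problem) in every name

open scoped BigOperators Pointwise

namespace Summit.ValiantsHypothesis.ValiantsHypothesis.Theorems.NewtonUnitEquationsDissociatedUniform

namespace TotalsLaw

open Literature.Computability.AlgebraicComplexity.KPTT.PlanarMinkowski

section WeakLifts

variable {q : ℕ} [NeZero q]

/-- **Left turns decide the higher neighbour.**  For a left-turning curve `z ↦ (r z, h z)` whose chart functions `r + t·h` are all
cyclically unimodal, a strict maximiser `x` of `r + t·h` with some label higher than `x` has `h x < h (x + 1)`. [folklore] -/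
theorem higher_succ_of_mode_weak (r h : ZMod q → ℝ) (hcu : ∀ t : ℝ, CycUnimodal fun z => r z + t * h z)
    (hL : ∀ z : ZMod q, 0 ≤ (r (z + 1) - r z) * (h (z + 2) - h (z + 1)) - (h (z + 1) - h z) * (r (z + 2) - r (z + 1)))
    {t : ℝ} {x : ZMod q} (hmode : ∀ z : ZMod q, z ≠ x → r z + t * h z < r x + t * h x) {y : ZMod q} (hy : h x < h y) :
    h x < h (x + 1) := by
  have hxy : x ≠ y := fun he => by rw [he] at hy; exact lt_irrefl _ hy
  have h10 : (1 : ZMod q) ≠ 0 := one_ne_zero_of_ne hxy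
  have hx1 : x + 1 ≠ x := fun he => h10 (by simpa using he)
  have hx2 : x - 1 ≠ x := fun he => h10 (by
    have : x = x - 1 + 1 := by ring
    rw [he] at this; simpa using this.symm)
  rcases exists_higher_neighbour_of_isTop r h hcu hmode hy with hup | hdown
  · exact hup
  · -- `h (x-1) > h x`: a non-higher successor would contradict the left turn at `x - 1`
    by_contra hcon
    push Not at hcon
    have h1 := hmode (x - 1) hx2
    have h2 := hmode (x + 1) hx1
    have h3 := hL (x - 1)
    rw [show x - 1 + 1 = x by ring, show x - 1 + 2 = x + 1 by ring] at h3
    -- `A := -(h x - h(x-1)) * (2) < 0`, `B := -(h(x+1) - h x) * (1) ≥ 0`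
    have hA : 0 < -(h x - h (x - 1)) := by linarith
    have hB : 0 ≤ -(h (x + 1) - h x) := by linarith
    have A : -(h x - h (x - 1)) * (r (x + 1) + t * h (x + 1) - (r x + t * h x)) < 0 :=
      mul_neg_of_pos_of_neg hA (by linarith)
    have B : 0 ≤ -(h (x + 1) - h x) * (r x + t * h x - (r (x - 1) + t * h (x - 1))) :=
      mul_nonneg hB (by linarith)
    nlinarith [A, B, h3]

/-- **… and the lower neighbour**: a strict maximiser `x` with some label lower than `x` has `h (x - 1) < h x`. [folklore] -/
theorem lower_pred_of_mode_weak (r h : ZMod q → ℝ) (hcu : ∀ t : ℝ, CycUnimodal fun z => r z + t * h z)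
    (hL : ∀ z : ZMod q, 0 ≤ (r (z + 1) - r z) * (h (z + 2) - h (z + 1)) - (h (z + 1) - h z) * (r (z + 2) - r (z + 1)))
    {t : ℝ} {x : ZMod q} (hmode : ∀ z : ZMod q, z ≠ x → r z + t * h z < r x + t * h x) {y : ZMod q} (hy : h y < h x) :
    h (x - 1) < h x := by
  have hxy : y ≠ x := fun he => by rw [he] at hy; exact lt_irrefl _ hy
  have h10 : (1 : ZMod q) ≠ 0 := one_ne_zero_of_ne hxy
  have hx1 : x + 1 ≠ x := fun he => h10 (by simpa using he)
  have hx2 : x - 1 ≠ x := fun he => h10 (by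
    have : x = x - 1 + 1 := by ring
    rw [he] at this; simpa using this.symm)
  rcases exists_lower_neighbour_of_isTop r h hcu hmode hy with hup | hdown
  · -- `h (x+1) < h x`: a non-lower predecessor would contradict the left turn at `x - 1`
    by_contra hcon
    push Not at hcon
    have h1 := hmode (x - 1) hx2
    have h2 := hmode (x + 1) hx1
    have h3 := hL (x - 1)
    rw [show x - 1 + 1 = x by ring, show x - 1 + 2 = x + 1 by ring] at h3
    have hA : 0 < -(h (x + 1) - h x) := by linarith
    have hB : 0 ≤ -(h x - h (x - 1)) := by linarith
    have A : 0 < -(h (x + 1) - h x) * (r x + t * h x - (r (x - 1) + t * h (x - 1))) :=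
      mul_pos hA (by linarith)
    have B : -(h x - h (x - 1)) * (r (x + 1) + t * h (x + 1) - (r x + t * h x)) ≤ 0 :=
      mul_nonpos_of_nonneg_of_nonpos hB (by linarith)
    nlinarith [A, B, h3]
  · exact hdown

/-- **Chart modes sit on the ascending arc.**  With a min-based witness `(n, d)` for `h`, a strict maximiser `x` of some `r + t·h`
(left-turning curve, all chart functions unimodal) has position `(x - n).val ≤ d`. [folklore] -/
theorem pos_le_of_mode_weak (r h : ZMod q → ℝ) (hcu : ∀ t : ℝ, CycUnimodal fun z => r z + t * h z)
    (hL : ∀ z : ZMod q, 0 ≤ (r (z + 1) - r z) * (h (z + 2) - h (z + 1)) - (h (z + 1) - h z) * (r (z + 2) - r (z + 1)))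
    (hnc : ∃ y y' : ZMod q, h y ≠ h y') {n : ZMod q} {d : ℕ} (hnd : CycUnimodalAt h n d) (hmin : ∀ z, h n ≤ h z)
    {t : ℝ} {x : ZMod q} (hmode : ∀ z : ZMod q, z ≠ x → r z + t * h z < r x + t * h x) : (x - n).val ≤ d := by
  set k := (x - n).val with hk
  have hkq : k < q := ZMod.val_lt _
  have hx : x = n + (k : ZMod q) := eq_add_val n x
  by_contra hgt
  push Not at hgt
  -- some label differs in height from `x`
  have hne : ∃ y, h y ≠ h x := by
    by_contra hall
    push Not at hall
    obtain ⟨y, y', hyy⟩ := hnc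
    exact hyy ((hall y).trans (hall y').symm)
  obtain ⟨y, hy⟩ := hne
  rcases lt_or_gt_of_ne hy with hlt | hgt'
  · -- a lower label exists: `h (x-1) < h x`, but the descending step `k - 1 → k` gives `h x ≤ h (x-1)`
    have hpred := lower_pred_of_mode_weak r h hcu hL hmode hlt
    have hstep := hnd.2.2 (k - 1) (by omega) (by omega)
    rw [show k - 1 + 1 = k by omega, ← hx,
      show n + ((k - 1 : ℕ) : ZMod q) = x - 1 by rw [hx, Nat.cast_sub (by omega : 1 ≤ k)]; push_cast; ring] at hstep
    linarith
  · -- a higher label exists: `h x < h (x+1)`; on the descending run this needs `k = q - 1`, and then `x + 1 = n` is the minimum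
    have hsucc := higher_succ_of_mode_weak r h hcu hL hmode hgt'
    rcases Nat.lt_or_ge (k + 1) q with hk1 | hk1
    · have hstep := hnd.2.2 k (by omega) hk1
      rw [← hx, show n + ((k + 1 : ℕ) : ZMod q) = x + 1 by rw [hx]; push_cast; ring] at hstep
      linarith
    · have hkq1 : k = q - 1 := by omega
      have hx1 : x + 1 = n := by
        rw [hx, hkq1, Nat.cast_sub (by omega : 1 ≤ q), ZMod.natCast_self]; ring
      rw [hx1] at hsucc
      linarith [hmin x]

/-- **Positions of chart modes increase with time**: strict maximisers `x₁` of `r + t₁·h` and `x₂` of `r + t₂·h` with `t₁ < t₂`,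
`x₁ ≠ x₂`, have positions `(x₁ - n).val < (x₂ - n).val` for a min-based witness `(n, d)` of `h`. [folklore] -/
theorem pos_lt_pos_of_modes_weak (r h : ZMod q → ℝ) (hcu : ∀ t : ℝ, CycUnimodal fun z => r z + t * h z)
    (hL : ∀ z : ZMod q, 0 ≤ (r (z + 1) - r z) * (h (z + 2) - h (z + 1)) - (h (z + 1) - h z) * (r (z + 2) - r (z + 1)))
    (hnc : ∃ y y' : ZMod q, h y ≠ h y') {n : ZMod q} {d : ℕ} (hnd : CycUnimodalAt h n d) (hmin : ∀ z, h n ≤ h z) {t₁ t₂ : ℝ} (ht : t₁ < t₂) {x₁ x₂ : ZMod q}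
    (hne : x₁ ≠ x₂) (hm₁ : ∀ z : ZMod q, z ≠ x₁ → r z + t₁ * h z < r x₁ + t₁ * h x₁)
    (hm₂ : ∀ z : ZMod q, z ≠ x₂ → r z + t₂ * h z < r x₂ + t₂ * h x₂) : (x₁ - n).val < (x₂ - n).val := by
  -- heights increase along the chart
  have hh : h x₁ < h x₂ := by
    have e1 := hm₁ x₂ (Ne.symm hne)
    have e2 := hm₂ x₁ hne
    nlinarith
  have hk₁ := pos_le_of_mode_weak r h hcu hL hnc hnd hmin hm₁
  have hk₂ := pos_le_of_mode_weak r h hcu hL hnc hnd hmin hm₂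
  by_contra hge
  push Not at hge
  -- on the ascending arc, position order is height order
  have := hnd.asc_le hge hk₁
  rw [← eq_add_val n x₂, ← eq_add_val n x₁] at this
  linarith

/-- **Monotone forward lift of the chart modes.**  For a left-turning curve `z ↦ (r z, h z)` all of whose chart functions `r + t·h`
are cyclically unimodal (and `h` itself is), there are a base label `x₀` and a MONOTONE `P : ℝ → ℕ` with `P < q` such that the strict
maximiser of `r + t·h`, whenever it exists, is `x₀ + P t`. [folklore] -/
theorem exists_forward_lift_weak (r h : ZMod q → ℝ) (hcu : ∀ t : ℝ, CycUnimodal fun z => r z + t * h z) (hh : CycUnimodal h)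
    (hL : ∀ z : ZMod q, 0 ≤ (r (z + 1) - r z) * (h (z + 2) - h (z + 1)) - (h (z + 1) - h z) * (r (z + 2) - r (z + 1))) :
    ∃ (x₀ : ZMod q) (P : ℝ → ℕ), Monotone P ∧ (∀ t, P t < q) ∧
      ∀ (t : ℝ) (x : ZMod q), (∀ z : ZMod q, z ≠ x → r z + t * h z < r x + t * h x) → x = x₀ + (P t : ZMod q) := by
  classical
  have hq : 0 < q := Nat.pos_of_ne_zero (NeZero.ne q)
  by_cases hnc : ∃ y y' : ZMod q, h y ≠ h y'
  swap
  · -- constant height: the maximiser does not depend on `t`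
    push Not at hnc
    by_cases hex : ∃ (t : ℝ) (x : ZMod q), ∀ z : ZMod q, z ≠ x → r z + t * h z < r x + t * h x
    · obtain ⟨t₀, x₀, hx₀⟩ := hex
      refine ⟨x₀, fun _ => 0, fun _ _ _ => le_rfl, fun _ => hq, fun t x hmode => ?_⟩
      rw [Nat.cast_zero, add_zero]
      by_contra hne
      have e1 := hx₀ x hne
      have e2 := hmode x₀ (Ne.symm hne)
      rw [hnc x x₀] at e1 e2
      linarith
    · push Not at hex
      refine ⟨0, fun _ => 0, fun _ _ _ => le_rfl, fun _ => hq, fun t x hmode => ?_⟩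
      obtain ⟨z, hz, hle⟩ := hex t x
      exact absurd (hmode z hz) (not_lt.2 hle)
  obtain ⟨n, d, hnd, hmin⟩ := hh.exists_min_witness
  -- `P t` = the largest position of a mode seen up to time `t`
  let M : ℝ → Finset (ZMod q) := fun t =>
    Finset.univ.filter fun x => ∃ t' : ℝ, t' ≤ t ∧ ∀ z : ZMod q, z ≠ x → r z + t' * h z < r x + t' * h x
  let P : ℝ → ℕ := fun t => (M t).sup fun x => (x - n).val
  refine ⟨n, P, fun t₁ t₂ ht => ?_, fun t => ?_, fun t x hmode => ?_⟩
  · -- monotone: the filter grows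
    apply Finset.sup_mono
    intro x hx
    obtain ⟨t', ht', hm⟩ := (Finset.mem_filter.1 hx).2
    exact Finset.mem_filter.2 ⟨Finset.mem_univ _, t', ht'.trans ht, hm⟩
  · -- `P t < q`
    simp only [P]
    refine lt_of_le_of_lt (Finset.sup_le fun x _ => (Nat.le_sub_one_of_lt (ZMod.val_lt (x - n)))) (by omega)
  · -- at a mode time, `P t` is the position of the mode
    have hxM : x ∈ M t := Finset.mem_filter.2 ⟨Finset.mem_univ _, t, le_rfl, hmode⟩
    have hPx : P t = (x - n).val := by
      apply le_antisymm
      · refine Finset.sup_le fun x' hx' => ?_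
        obtain ⟨t', ht', hm'⟩ := (Finset.mem_filter.1 hx').2
        by_cases hxx : x' = x
        · rw [hxx]
        rcases lt_or_eq_of_le ht' with hlt | heq
        · exact (pos_lt_pos_of_modes_weak r h hcu hL hnc hnd hmin hlt hxx hm' hmode).le
        · -- two strict maximisers at the same time coincide
          exfalso
          rw [heq] at hm'
          have e1 := hm' x (Ne.symm hxx)
          have e2 := hmode x' hxx
          linarith
      · exact Finset.le_sup (f := fun x => (x - n).val) hxM
    rw [hPx]
    exact eq_add_val n x

end WeakLifts

section WeakTurning

variable {q : ℕ} [NeZero q]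

/-- The curve `a : ℤ/q → ℝ²` NEVER TURNS RIGHT: `det(a(z+1) − a z, a(z+2) − a(z+1)) ≥ 0` at every label (counter-clockwise, collinear
consecutive triples allowed). [folklore] -/
def WeakLeftTurning (a : ZMod q → (Fin 2 → ℝ)) : Prop :=
  ∀ z : ZMod q, 0 ≤ (a (z + 1) 0 - a z 0) * (a (z + 2) 1 - a (z + 1) 1) - (a (z + 1) 1 - a z 1) * (a (z + 2) 0 - a (z + 1) 0)

/-- The curve NEVER TURNS LEFT: `det(a(z+1) − a z, a(z+2) − a(z+1)) ≤ 0` at every label (clockwise, collinear triples allowed). [folklore] -/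
def WeakRightTurning (a : ZMod q → (Fin 2 → ℝ)) : Prop :=
  ∀ z : ZMod q, (a (z + 1) 0 - a z 0) * (a (z + 2) 1 - a (z + 1) 1) - (a (z + 1) 1 - a z 1) * (a (z + 2) 0 - a (z + 1) 0) ≤ 0

variable (a : ZMod q → (Fin 2 → ℝ))

/-- **Lifts of a weakly left-turning curve**: on the chart `σ = 1` the strict modes are `x₀ + P t`, on the chart `σ = -1` they are
`x₀' + P' (-t)`, with `P, P' : ℝ → ℕ` monotone and `< q`. [folklore] -/
theorem exists_lifts_of_weakLeftTurning (ha : ConvexlyOrdered a) (hai : Function.Injective a) (hL : WeakLeftTurning a) :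
    (∃ (x₀ : ZMod q) (P : ℝ → ℕ), Monotone P ∧ (∀ t, P t < q) ∧
      ∀ (t : ℝ) (x : ZMod q), IsStrictTop ![1, t] (Finset.univ.image a) (a x) → x = x₀ + (P t : ZMod q)) ∧
    (∃ (x₀ : ZMod q) (P : ℝ → ℕ), Monotone P ∧ (∀ t, P t < q) ∧
      ∀ (t : ℝ) (x : ZMod q), IsStrictTop ![-1, t] (Finset.univ.image a) (a x) → x = x₀ + (P (-t) : ZMod q)) := by
  constructor
  · -- chart `1`: the family `a·0 + t·a·1`
    have hcu : ∀ t : ℝ, CycUnimodal fun z => a z 0 + t * a z 1 := fun t => by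
      obtain ⟨n, d, hnd⟩ := ha ![1, t]
      refine ⟨n, d, ?_⟩
      have : (fun z => ![1, t] ⬝ᵥ a z) = fun z => a z 0 + t * a z 1 := by
        funext z; rw [chart_dotProduct, one_mul]
      rw [← this]; exact hnd
    have hh : CycUnimodal fun z => a z 1 := by
      obtain ⟨n, d, hnd⟩ := ha ![0, 1]
      refine ⟨n, d, ?_⟩
      have : (fun z => ![0, 1] ⬝ᵥ a z) = fun z => a z 1 := by
        funext z; rw [chart_dotProduct, zero_mul, one_mul, zero_add]
      rw [← this]; exact hnd
    obtain ⟨x₀, P, hP, hPq, hmode⟩ := exists_forward_lift_weak (fun z => a z 0) (fun z => a z 1) hcu hh hL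
    refine ⟨x₀, P, hP, hPq, fun t x htop => hmode t x fun z hz => ?_⟩
    have := labelMode_of_isStrictTop a hai htop z hz
    simpa only [one_mul] using this
  · -- chart `-1`: the point-reflected family `-a·0 + s·(-a·1)` at `s = -t`
    have hcu : ∀ s : ℝ, CycUnimodal fun z => -a z 0 + s * -a z 1 := fun s => by
      obtain ⟨n, d, hnd⟩ := ha ![-1, -s]
      refine ⟨n, d, ?_⟩
      have : (fun z => ![-1, -s] ⬝ᵥ a z) = fun z => -a z 0 + s * -a z 1 := by
        funext z; rw [chart_dotProduct]; ring
      rw [← this]; exact hnd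
    have hh : CycUnimodal fun z => -a z 1 := by
      obtain ⟨n, d, hnd⟩ := ha ![0, -1]
      refine ⟨n, d, ?_⟩
      have : (fun z => ![0, -1] ⬝ᵥ a z) = fun z => -a z 1 := by
        funext z; rw [chart_dotProduct]; ring
      rw [← this]; exact hnd
    have hL' : ∀ z : ZMod q, 0 ≤ (-a (z + 1) 0 - -a z 0) * (-a (z + 2) 1 - -a (z + 1) 1) -
        (-a (z + 1) 1 - -a z 1) * (-a (z + 2) 0 - -a (z + 1) 0) := fun z => by
      have := hL z; linarith
    obtain ⟨x₀, P, hP, hPq, hmode⟩ := exists_forward_lift_weak (fun z => -a z 0) (fun z => -a z 1) hcu hh hL'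
    refine ⟨x₀, P, hP, hPq, fun t x htop => hmode (-t) x fun z hz => ?_⟩
    have := labelMode_of_isStrictTop a hai htop z hz
    linarith

/-- **Lifts of a weakly right-turning curve**: on the chart `σ = 1` the strict modes are `x₀ + P (-t)`, on the chart `σ = -1` they are
`x₀' + P' t`. [folklore] -/
theorem exists_lifts_of_weakRightTurning (ha : ConvexlyOrdered a) (hai : Function.Injective a) (hR : WeakRightTurning a) :
    (∃ (x₀ : ZMod q) (P : ℝ → ℕ), Monotone P ∧ (∀ t, P t < q) ∧
      ∀ (t : ℝ) (x : ZMod q), IsStrictTop ![1, t] (Finset.univ.image a) (a x) → x = x₀ + (P (-t) : ZMod q)) ∧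
    (∃ (x₀ : ZMod q) (P : ℝ → ℕ), Monotone P ∧ (∀ t, P t < q) ∧
      ∀ (t : ℝ) (x : ZMod q), IsStrictTop ![-1, t] (Finset.univ.image a) (a x) → x = x₀ + (P t : ZMod q)) := by
  constructor
  · -- chart `1`: the family `a·0 + s·(-a·1)` at `s = -t` (vertical reflection turns right into left)
    have hcu : ∀ s : ℝ, CycUnimodal fun z => a z 0 + s * -a z 1 := fun s => by
      obtain ⟨n, d, hnd⟩ := ha ![1, -s]
      refine ⟨n, d, ?_⟩
      have : (fun z => ![1, -s] ⬝ᵥ a z) = fun z => a z 0 + s * -a z 1 := by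
        funext z; rw [chart_dotProduct]; ring
      rw [← this]; exact hnd
    have hh : CycUnimodal fun z => -a z 1 := by
      obtain ⟨n, d, hnd⟩ := ha ![0, -1]
      refine ⟨n, d, ?_⟩
      have : (fun z => ![0, -1] ⬝ᵥ a z) = fun z => -a z 1 := by
        funext z; rw [chart_dotProduct]; ring
      rw [← this]; exact hnd
    have hL' : ∀ z : ZMod q, 0 ≤ (a (z + 1) 0 - a z 0) * (-a (z + 2) 1 - -a (z + 1) 1) -
        (-a (z + 1) 1 - -a z 1) * (a (z + 2) 0 - a (z + 1) 0) := fun z => by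
      have := hR z; linarith
    obtain ⟨x₀, P, hP, hPq, hmode⟩ := exists_forward_lift_weak (fun z => a z 0) (fun z => -a z 1) hcu hh hL'
    refine ⟨x₀, P, hP, hPq, fun t x htop => hmode (-t) x fun z hz => ?_⟩
    have := labelMode_of_isStrictTop a hai htop z hz
    linarith
  · -- chart `-1`: the family `-a·0 + t·a·1` (horizontal reflection)
    have hcu : ∀ t : ℝ, CycUnimodal fun z => -a z 0 + t * a z 1 := fun t => by
      obtain ⟨n, d, hnd⟩ := ha ![-1, t]
      refine ⟨n, d, ?_⟩
      have : (fun z => ![-1, t] ⬝ᵥ a z) = fun z => -a z 0 + t * a z 1 := by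
        funext z; rw [chart_dotProduct]; ring
      rw [← this]; exact hnd
    have hh : CycUnimodal fun z => a z 1 := by
      obtain ⟨n, d, hnd⟩ := ha ![0, 1]
      refine ⟨n, d, ?_⟩
      have : (fun z => ![0, 1] ⬝ᵥ a z) = fun z => a z 1 := by
        funext z; rw [chart_dotProduct, zero_mul, one_mul, zero_add]
      rw [← this]; exact hnd
    have hL' : ∀ z : ZMod q, 0 ≤ (-a (z + 1) 0 - -a z 0) * (a (z + 2) 1 - a (z + 1) 1) -
        (a (z + 1) 1 - a z 1) * (-a (z + 2) 0 - -a (z + 1) 0) := fun z => by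
      have := hR z; linarith
    obtain ⟨x₀, P, hP, hPq, hmode⟩ := exists_forward_lift_weak (fun z => -a z 0) (fun z => a z 1) hcu hh hL'
    refine ⟨x₀, P, hP, hPq, fun t x htop => hmode t x fun z hz => ?_⟩
    have := labelMode_of_isStrictTop a hai htop z hz
    linarith

variable (b : ZMod q → (Fin 2 → ℝ))

/-- **The uniform pointwise bound for WEAKLY co-oriented convexly ordered pairs** (collinear consecutive triples allowed).  If `a` and `b`
are convexly ordered, injective and BOTH weakly left-turning or BOTH weakly right-turning, then `#vert conv U_s(Z) ≤ 12·q` for all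
position sets `Z` and classes `s` (generalises `unionVert_le_twelve_mul` of `…TotalsLawLeftTurning` to degenerate polygons). [folklore] -/
theorem unionVert_le_twelve_mul_of_weak (ha : ConvexlyOrdered a) (hb : ConvexlyOrdered b) (hai : Function.Injective a)
    (hbi : Function.Injective b) (hturn : (WeakLeftTurning a ∧ WeakLeftTurning b) ∨ (WeakRightTurning a ∧ WeakRightTurning b))
    (Z : Finset (ZMod q)) (s : ZMod q) : unionVert a b (Z : Set (ZMod q)) s ≤ 12 * q := by
  refine unionVert_le_of_lifts a b ha hb Z s fun σ hσ => ?_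
  rcases hturn with ⟨hLa, hLb⟩ | ⟨hRa, hRb⟩
  · obtain ⟨⟨x₀, P, hP, hPq, hPA⟩, ⟨x₀', P', hP', hP'q, hPA'⟩⟩ := exists_lifts_of_weakLeftTurning a ha hai hLa
    obtain ⟨⟨y₀, Q, hQ, hQq, hQB⟩, ⟨y₀', Q', hQ', hQ'q, hQB'⟩⟩ := exists_lifts_of_weakLeftTurning b hb hbi hLb
    rcases hσ with rfl | rfl
    · exact ⟨ℝ, inferInstance, inferInstance, id, x₀, y₀, P, Q, hP, hQ, hPq, hQq, hPA, hQB⟩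
    · exact ⟨ℝ, inferInstance, inferInstance, fun t => -t, x₀', y₀', P', Q', hP', hQ', hP'q, hQ'q, hPA', hQB'⟩
  · obtain ⟨⟨x₀, P, hP, hPq, hPA⟩, ⟨x₀', P', hP', hP'q, hPA'⟩⟩ := exists_lifts_of_weakRightTurning a ha hai hRa
    obtain ⟨⟨y₀, Q, hQ, hQq, hQB⟩, ⟨y₀', Q', hQ', hQ'q, hQB'⟩⟩ := exists_lifts_of_weakRightTurning b hb hbi hRb
    rcases hσ with rfl | rfl
    · exact ⟨ℝ, inferInstance, inferInstance, fun t => -t, x₀, y₀, P, Q, hP, hQ, hPq, hQq, hPA, hQB⟩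
    · exact ⟨ℝ, inferInstance, inferInstance, id, x₀', y₀', P', Q', hP', hQ', hP'q, hQ'q, hPA', hQB'⟩

/-- **The union totals law for weakly co-oriented convexly ordered pairs**: `unionTotal a b Z ≤ 12·q²` for every position set. [folklore] -/
theorem unionTotal_le_twelve_mul_sq_of_weak (ha : ConvexlyOrdered a) (hb : ConvexlyOrdered b) (hai : Function.Injective a)
    (hbi : Function.Injective b) (hturn : (WeakLeftTurning a ∧ WeakLeftTurning b) ∨ (WeakRightTurning a ∧ WeakRightTurning b))
    (Z : Finset (ZMod q)) : unionTotal a b (Z : Set (ZMod q)) ≤ 12 * q ^ 2 := by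
  unfold unionTotal
  calc ∑ s, unionVert a b (Z : Set (ZMod q)) s ≤ ∑ _s : ZMod q, 12 * q :=
        Finset.sum_le_sum fun s _ => unionVert_le_twelve_mul_of_weak a b ha hb hai hbi hturn Z s
    _ = 12 * q ^ 2 := by rw [Finset.sum_const, Finset.card_univ, ZMod.card, smul_eq_mul]; ring

/-- **The `n = 3` class law on this stratum**: a third curve with at most `m` values over a weakly co-oriented convexly ordered injective
pair has `T(a, b, c) ≤ 12·m·q²`. [folklore] -/
theorem totalVert_le_of_weakCoOriented (ha : ConvexlyOrdered a) (hb : ConvexlyOrdered b) (hai : Function.Injective a)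
    (hbi : Function.Injective b) (hturn : (WeakLeftTurning a ∧ WeakLeftTurning b) ∨ (WeakRightTurning a ∧ WeakRightTurning b))
    (c : ZMod q → (Fin 2 → ℝ)) [DecidableEq (Fin 2 → ℝ)] {m : ℕ} (hm : (Finset.univ.image c).card ≤ m) :
    totalVert a b c ≤ 12 * m * q ^ 2 := by
  classical
  have hlevel : ∀ v : Fin 2 → ℝ, unionTotal a b (c ⁻¹' {v}) ≤ 12 * q ^ 2 := by
    intro v
    have hset : (c ⁻¹' {v} : Set (ZMod q)) = ((Finset.univ.filter fun z => c z = v : Finset (ZMod q)) : Set (ZMod q)) := by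
      ext z; simp
    rw [hset]
    exact unionTotal_le_twelve_mul_sq_of_weak a b ha hb hai hbi hturn _
  calc totalVert a b c ≤ ∑ v ∈ Finset.univ.image c, unionTotal a b (c ⁻¹' {v}) := totalVert_le_sum_unionTotal a b c
    _ ≤ ∑ _v ∈ Finset.univ.image c, 12 * q ^ 2 := Finset.sum_le_sum fun v _ => hlevel v
    _ = (Finset.univ.image c).card * (12 * q ^ 2) := by rw [Finset.sum_const, smul_eq_mul]
    _ ≤ m * (12 * q ^ 2) := Nat.mul_le_mul_right _ hm
    _ = 12 * m * q ^ 2 := by ring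

end WeakTurning

end TotalsLaw

end Summit.ValiantsHypothesis.ValiantsHypothesis.Theorems.NewtonUnitEquationsDissociatedUniform
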